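import Literature.MathematicalPhysics.QuantumFieldTheory.Balaban1983to89.B9Eq371HessianSplitY
import Literature.MathematicalPhysics.QuantumFieldTheory.Balaban1983to89.B9Cor35GCubeInputsAtOne
import Literature.MathematicalPhysics.QuantumFieldTheory.Balaban1983to89.Node00.OpsYNablaBridge

/-!
# `Balaban1983to89.B9Eq371CoCurlLeibnizY` — [B9] (3.71) p. 404, SECOND EQUALITY, AT def-Y'S LETTERS: the OUTPUT-SIDE PRODUCT RULE for the flat co-curl of the
# zeroth-order word (`−c_f·D*₁∘K_V = B¹⁰_V + Σ_μ W_{V,μ}∘∇_μ`), hence ★★★ `Δ(1) − Δ(V) = V⁰ + Σ_μ V¹_μ∘∇_μ` with EXPLICIT letters `V0Y`, `V1Y`, and its realification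
# = the `hLap` input of G-F5's `cor35_G_cube_of_pieces` (sub-row G-B9-LETTERS, module M5.1b-G, FILE G-F5a part II; identities only, no estimates)

T. Bałaban, *Propagators for lattice gauge theories in a background field*, Commun. Math. Phys. **99** (1985) 389–434
[`Balaban1985BackgroundPropagators`, "B9"]; [4] = Commun. Math. Phys. **96** (1984) 223–250 [`Balaban1984PropagatorsII`].

statement-level skeleton of published theorems with citation tags; proofs where landed; nothing here is a claim about the
Yang–Mills mass gap

THE PRINTED LOCUS (verbatim, held `paper:balaban1985-cmp99-background-propagators` p0016–p0017 = pp. 404–405).  (3.70)–(3.71) p. 404: *«(D_{U′U}A′)_{μν}(x) =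
(D_UA′)_{μν}(x) + η⁻¹(exp ηi ad_{A_μ(x)} − 1)R(U(x,x+ηe_μ))A′_ν(x+ηe_μ) − η⁻¹(exp ηi ad_{A_ν(x)} − 1)R(U(x,x+ηe_ν))A′_μ(x+ηe_ν), (3.70) … (D\*_{U′U}D_{U′U}A′)_μ(x) =
(D\*_UD_UA′)_μ(x) − Σ_ν[ … R(U(x,x−ηe_ν))i ad_{A_μ(x−ηe_ν)}(D_μA′_ν)(x−ηe_ν) … − i ad_{A_ν(x)}(D_νA′_μ)(x) − i ad_{A_μ(x)}(D_μA′_ν)(x) … ] − (F_{1,k}(A)A′)_μ(x) =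
(D\*DA′)_μ(x) − (V₁(A)A′)_μ(x). (3.71)»*; p. 405: *«The operator V₁ satisfies |(V₁(A)A′)(b)| ≦ O(1)(|∇A||A′| + |A|²|A′|) + O(1)|A|(|∇_UA′| + …) ≦ O(1)α₁((Lʲη)⁻¹|∇_UA′| +
(Lʲη)⁻²|A′|), b ∈ Ω_j, (3.73) … The derivatives are, of course, the covariant derivatives defined by U.»* (here `U = 1`: flat `∇_μ`).

WHY THIS FILE (cell `lit-balaban`, sub-row G-B9-LETTERS; module M5.1b-G after part I `B9Eq371HessianSplitY` p646838 ✓ and the assembly `B9Cor35GAtCubeLetters` p645320 ✓).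
Part I split `Δ(1) − Δ(V)` into four terms, three already of the right shape; the remaining one, `B₁ = −c_f·D*₁∘K_V` — the FLAT co-curl of the zeroth-order word
`(K_VX)(p_{μν}(x)) = (R(V_μ(x)) − 1)X(x+e_μ,ν) − (R(V_ν(x)) − 1)X(x+e_ν,μ)` — has entries `c_f²·‖V − 1‖`, too large by the factor `Lⁿ` for a `V⁰`-majorant; print's second
equality of (3.71) moves the outer difference onto the coefficient (→ `|∇A||A′|`, the VARIATION of the transporter) and onto `X` (→ `|A||∇A′|`, a first-order word).  THIS FILE
proves that product rule at def-Y's letters as an exact identity of `ℂ`-linear maps, then assembles ★★★ `hessY 1 − hessY V = V0Y V + Σ_μ V1Y V μ ∘ₗ nablaY μ` and its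
realification `conj b((hessY 1 − hessY V)^ℝ) = conj b(V0Y^ℝ) + Σ_μ conj b(V1Y μ^ℝ)·DK b i μ` — literally the `hLap` hypothesis of `B9Cor35GAtCubeLetters.cor35_G_cube_of_pieces`
(`lapPieceK b i V` is the left side by definition).  What remains for G-F5a is the ESTIMATES file: (3.73)-sized majorants of `conj b(V0Y^ℝ)`, `conj b(V1Y μ^ℝ)` over
`toB6 (geoCK i □)` from the (3.37) windows (‖V_b − 1‖ ≤ α₁η∕len, ‖V_b − V_{b−e_μ}‖ ≤ α₁η²∕len², ‖Hol_V(p) − 1‖ ≤ α₁η²∕len²) — every letter below is an explicit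
finite stencil with those coefficients.

WHAT THIS FILE PROVES (THEOREMS + `def`s with bodies: `B10dirY`, `B10Y`, `WY`, `V0Y`, `V1Y`; 0 `def … : Prop`, 0 sorry).
* §1 `unshift_shift_comm` (torus sites; `shift_unshift` is def-Y's); ★ `coCurlY_one_apply` — the flat co-curl pointwise as transverse backward differences:
  `(D*₁F)(⟨x,κ⟩) = c_f·Σ_μ{[μ<κ](F(p_{μκ}(x−e_μ)) − F(p_{μκ}(x))) − [κ<μ](F(p_{κμ}(x−e_μ)) − F(p_{κμ}(x)))}`.
* §2 `B10dirY`/`B10Y` (the `V⁰`-part: transporter VARIATIONS `R(V_a(x)) − R(V_a(x−e_μ))`, factor `c_f²`), `WY V μ` (the `V¹`-words: `(R(V(x−e_μ)) − 1)` on `Y(b)` and on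
  `Y(x+e_κ−e_μ, μ)`, factor `c_f`), `coCurl_KY_summand` (both orientations give one closed form — `K_V` is odd under the swap), ★★★ `neg_cf_coCurlY_one_KY_apply` ∕
  `neg_cf_coCurlY_one_comp_KY`: `−c_f·(coCurlY 1 ∘ₗ KY V) = B10Y V + Σ_μ WY V μ ∘ₗ nablaY μ`.
* §3 `V0Y V := B10Y V − c_f·(coCurlY V∘jordanY V − coCurlY 1)∘KY V − curv2Y V`, `V1Y V μ := WY V μ − (coCurlY V∘jordanY V − coCurlY 1)∘selY μ`,
  ★★★ `hessY_one_sub_hessY_eq` (`hessY 1 − hessY V = V0Y V + Σ_μ V1Y V μ ∘ₗ nablaY μ`), `conj_add''`, `conj_finset_sum`, ★★★ `conj_hessY_one_sub_hessY_eq` (realified).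

HONEST SCOPE.  Exact identities (finite-difference algebra on the torus; def-Y's letters, part I's `nablaY`/`selY`/`KY`, p38's `coCurlY_apply_eq`, def-Y's
`cdsS_one`/`shiftY_symm_chartY`/`extP_chartY`); no estimate, no window, no majorant.  Count-neutral; NOT a node discharge; no summit ∕ sub-problem statement is proved;
nothing continuum ∕ OS ∕ mass-gap ∕ Clay; YM mass gap NOT proved by any of this (Track A conditional rung).  No `sorry`, no `axiom`, no `… : Prop` fact, no `instance`, no
`notation`.  NEW file; nothing landed is modified.  Cell `lit-balaban`, seat `lit-balaban-p38` gen 42, 2026-08-28; `--supports stmt-QuantumFields-19200`.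
Net new unproved facts: 0.

RELATED IN THE TREE, NOT DUPLICATED: part I `B9Eq371HessianSplitY` (used); cell pub-balaban t4's `B9Eq371BondPrincipalTwoBackgroundSplit.q_unshift_sub_q_eq` ∕
`norm_covLapPrincipal_sub_flat_apply_le` (the same product rule, POINTWISE WITH NORMS, for abstract transporters on `B9Eq34CovCurlVector`'s carriers, no `𝒦`, no `Δ′`);
r06's `B9Eq371Composition`/`B9Eq371GradLetters` (torus letters, print's `exp ηi ad_A` expansion).
-/

noncomputable section

namespace Literature.MathematicalPhysics.QuantumFieldTheory.Balaban1983to89.B9Eq371CoCurlLeibnizY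

open Node00
open Literature.MathematicalPhysics.QuantumFieldTheory.Balaban1983to89
open Literature.MathematicalPhysics.QuantumFieldTheory.Balaban1983to89.B6KLevelCensusIndexV1 (KIdx)
open Literature.MathematicalPhysics.QuantumFieldTheory.Balaban1983to89.B6GlobalChartV1 (PV)
open Literature.MathematicalPhysics.QuantumFieldTheory.Balaban1983to89.B9Eq39Adjoint (R R_add R_sub R_smul)
open Literature.MathematicalPhysics.QuantumFieldTheory.Balaban1983to89.B9Eq3104CommutatorGradFormCurl (coCurlY_apply_eq extP_chartY)
open Literature.MathematicalPhysics.QuantumFieldTheory.Balaban1983to89.B9Eq371HessianSplitY (nablaY nablaY_apply KY KY_apply selY hessY_one_sub_hessY_split)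
open Literature.MathematicalPhysics.QuantumFieldTheory.Balaban1983to89.B9Cor35GCubeInputsAtOne (DK)
open Literature.MathematicalPhysics.QuantumFieldTheory.Balaban1983to89.Node00.OpsYNablaBridge (shiftY_symm_chartY shift_unshift)

variable {d ℓ : ℕ} {hd : 1 ≤ d + 1} {hL : Odd (ℓ + 1) ∧ 1 < ℓ + 1} {b₀ b₁ : ℝ}
variable {𝔸 : Type} [NormedRing 𝔸] [NormedAlgebra ℂ 𝔸] [CompleteSpace 𝔸]
variable (i : KIdx d ℓ hd hL b₀ b₁)

/-! ## §1  Torus-site bookkeeping and the flat co-curl at `U = 1`, pointwise, as transverse backward differences -/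

/-- `(x − e_μ) + e_a = (x + e_a) − e_μ` on the torus `T_η`. [cite: Balaban1985BackgroundPropagators, (3.3) p.390, bookkeeping] -/
theorem unshift_shift_comm (x : Site (PV d ℓ i.m i.K hd hL) 0) (μ a : Fin (d + 1)) : (x.unshift μ).shift a = (x.shift a).unshift μ := by
  funext ν
  by_cases ha : ν = a
  · subst ha
    by_cases hμ : ν = μ
    · subst hμ; simp [Site.shift, Site.unshift]
    · simp [Site.shift, Site.unshift, Function.update_of_ne hμ]
  · by_cases hμ : ν = μ
    · subst hμ; simp [Site.shift, Site.unshift, Function.update_of_ne ha]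
    · simp [Site.shift, Site.unshift, Function.update_of_ne ha, Function.update_of_ne hμ]

/-- ★ **THE FLAT CO-CURL, POINTWISE, AS TRANSVERSE BACKWARD DIFFERENCES** ((3.9) at `U = 1`): for a bond `b = ⟨x, κ⟩`,
`(D*₁F)(b) = c_f·Σ_μ { [μ < κ]·(F(p_{μκ}(x − e_μ)) − F(p_{μκ}(x))) − [κ < μ]·(F(p_{κμ}(x − e_μ)) − F(p_{κμ}(x))) }` — each plaquette through `b` with `b` a
base edge is paired with its translate by `−e_μ` (through `b` as a shifted edge). [cite: Balaban1985BackgroundPropagators, (3.9) p.392, (3.71) p.404 (2nd equality)] -/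
theorem coCurlY_one_apply (F : PlaqY i → 𝔸) (b : FBondY i) :
    coCurlY i (fun _ _ => (1 : 𝔸ˣ)) F b = ((i.cf : ℝ) : ℂ) • ∑ μ : Fin (d + 1),
      ((if h : μ < b.dir then F ⟨b.src.unshift μ, μ, b.dir, h⟩ - F ⟨b.src, μ, b.dir, h⟩ else 0) -
        (if h : b.dir < μ then F ⟨b.src.unshift μ, b.dir, μ, h⟩ - F ⟨b.src, b.dir, μ, h⟩ else 0)) := by
  rw [coCurlY_apply_eq]
  congr 1
  refine Finset.sum_congr rfl fun μ _ => ?_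
  rw [cdsS_one, cdsS_one, shiftY_symm_chartY, extP_chartY, extP_chartY, extP_chartY, extP_chartY]
  by_cases h1 : μ < b.dir
  · have h2 : ¬ b.dir < μ := lt_asymm h1
    simp only [h1, h2, dif_pos, dif_neg, not_false_eq_true, sub_zero, sub_self]
  · by_cases h2 : b.dir < μ
    · simp only [h1, h2, dif_pos, dif_neg, not_false_eq_true, sub_self, zero_sub]
    · simp only [h1, h2, dif_neg, not_false_eq_true, sub_self]


/-! ## §2  (3.71), second equality, for the flat co-curl of the zeroth-order word: `−c_f·D*₁∘K_V = B¹⁰_V + Σ_μ W_{V,μ}∘∇_μ` -/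

/-- **the direction-`μ` summand of the `V⁰`-part of `−c_f·D*₁∘K_V`** (without the factor `c_f²`): at `b = ⟨x, κ⟩`, `μ ≠ κ`,
`[R(V_μ(x)) − R(V_μ(x−e_μ))]X(⟨x+e_μ, κ⟩) − [R(V_κ(x)) − R(V_κ(x−e_μ))]X(⟨x+e_κ, μ⟩)` — coefficients = nearest-neighbour VARIATIONS of the transporters (print's `|∇A|·|A′|`
term of (3.73)). [cite: Balaban1985BackgroundPropagators, (3.71) p.404, (3.73) p.405] -/
def B10dirY (V : CfgY 𝔸 i) (μ : Fin (d + 1)) : (FBondY i → 𝔸) →ₗ[ℂ] (FBondY i → 𝔸) where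
  toFun X := fun b => if μ = b.dir then 0 else
    ((R (V μ b.src) (X ⟨b.src.shift μ, b.dir⟩) - R (V μ (b.src.unshift μ)) (X ⟨b.src.shift μ, b.dir⟩)) -
      (R (V b.dir b.src) (X ⟨b.src.shift b.dir, μ⟩) - R (V b.dir (b.src.unshift μ)) (X ⟨b.src.shift b.dir, μ⟩)))
  map_add' X X' := by
    funext b
    simp only [Pi.add_apply, R_add]
    split_ifs
    · simp
    · abel
  map_smul' c X := by
    funext b
    simp only [Pi.smul_apply, R_smul, RingHom.id_apply]
    split_ifs
    · simp
    · simp only [smul_sub]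

/-- **the `V⁰`-part of `−c_f·D*₁∘K_V`**, `B¹⁰_V := c_f²·Σ_μ B¹⁰_{V,μ}`. [cite: Balaban1985BackgroundPropagators, (3.71) p.404, (3.73) p.405] -/
def B10Y (V : CfgY 𝔸 i) : (FBondY i → 𝔸) →ₗ[ℂ] (FBondY i → 𝔸) :=
  (((i.cf : ℝ) : ℂ) * ((i.cf : ℝ) : ℂ)) • ∑ μ : Fin (d + 1), B10dirY i V μ

/-- `B¹⁰_V` evaluated. [cite: Balaban1985BackgroundPropagators, (3.71) p.404, bookkeeping] -/
theorem B10Y_apply (V : CfgY 𝔸 i) (X : FBondY i → 𝔸) (b : FBondY i) :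
    B10Y i V X b = (((i.cf : ℝ) : ℂ) * ((i.cf : ℝ) : ℂ)) • ∑ μ : Fin (d + 1),
      (if μ = b.dir then 0 else
        ((R (V μ b.src) (X ⟨b.src.shift μ, b.dir⟩) - R (V μ (b.src.unshift μ)) (X ⟨b.src.shift μ, b.dir⟩)) -
          (R (V b.dir b.src) (X ⟨b.src.shift b.dir, μ⟩) - R (V b.dir (b.src.unshift μ)) (X ⟨b.src.shift b.dir, μ⟩)))) := by
  simp only [B10Y, LinearMap.smul_apply, LinearMap.coe_sum, Finset.sum_apply, Pi.smul_apply]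
  rfl

/-- **the `V¹`-words of `−c_f·D*₁∘K_V`**: `(W_{V,μ}Y)(⟨x, κ⟩) = [μ ≠ κ]·c_f·{(R(V_μ(x−e_μ)) − 1)Y(⟨x, κ⟩) − (R(V_κ(x−e_μ)) − 1)Y(⟨x+e_κ−e_μ, μ⟩)}` (to be composed with `∇_μ`; print's
`|A|·|∇A′|` term of (3.73)). [cite: Balaban1985BackgroundPropagators, (3.71) p.404, (3.73) p.405] -/
def WY (V : CfgY 𝔸 i) (μ : Fin (d + 1)) : (FBondY i → 𝔸) →ₗ[ℂ] (FBondY i → 𝔸) where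
  toFun Y := fun b => if μ = b.dir then 0 else ((i.cf : ℝ) : ℂ) •
    ((R (V μ (b.src.unshift μ)) (Y b) - Y b) -
      (R (V b.dir (b.src.unshift μ)) (Y ⟨(b.src.shift b.dir).unshift μ, μ⟩) - Y ⟨(b.src.shift b.dir).unshift μ, μ⟩))
  map_add' Y Y' := by
    funext b
    simp only [Pi.add_apply, R_add]
    split_ifs
    · simp
    · rw [← smul_add]; congr 1; abel
  map_smul' c Y := by
    funext b
    simp only [Pi.smul_apply, R_smul, RingHom.id_apply]
    split_ifs
    · simp
    · rw [smul_comm c]; simp only [smul_sub]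

/-- `W_{V,μ}` evaluated. [cite: Balaban1985BackgroundPropagators, (3.71) p.404, bookkeeping] -/
theorem WY_apply (V : CfgY 𝔸 i) (μ : Fin (d + 1)) (Y : FBondY i → 𝔸) (b : FBondY i) :
    WY i V μ Y b = if μ = b.dir then 0 else ((i.cf : ℝ) : ℂ) •
      ((R (V μ (b.src.unshift μ)) (Y b) - Y b) -
        (R (V b.dir (b.src.unshift μ)) (Y ⟨(b.src.shift b.dir).unshift μ, μ⟩) - Y ⟨(b.src.shift b.dir).unshift μ, μ⟩)) := rfl

/-- the summand of `D*₁(K_VX)` at a bond, in closed form: for `μ ≠ κ` both orientation cases give the same expression (the word `K_V` is odd under the swap of the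
plaquette's directions). [cite: Balaban1985BackgroundPropagators, (3.70)–(3.71) p.404, bookkeeping] -/
theorem coCurl_KY_summand (V : CfgY 𝔸 i) (X : FBondY i → 𝔸) (b : FBondY i) (μ : Fin (d + 1)) :
    ((if h : μ < b.dir then KY i V X ⟨b.src.unshift μ, μ, b.dir, h⟩ - KY i V X ⟨b.src, μ, b.dir, h⟩ else 0) -
        (if h : b.dir < μ then KY i V X ⟨b.src.unshift μ, b.dir, μ, h⟩ - KY i V X ⟨b.src, b.dir, μ, h⟩ else 0)) =
      if μ = b.dir then 0 else
        -(((R (V μ b.src) (X ⟨b.src.shift μ, b.dir⟩) - X ⟨b.src.shift μ, b.dir⟩) -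
              (R (V μ (b.src.unshift μ)) (X ⟨b.src, b.dir⟩) - X ⟨b.src, b.dir⟩)) -
            ((R (V b.dir b.src) (X ⟨b.src.shift b.dir, μ⟩) - X ⟨b.src.shift b.dir, μ⟩) -
              (R (V b.dir (b.src.unshift μ)) (X ⟨(b.src.shift b.dir).unshift μ, μ⟩) - X ⟨(b.src.shift b.dir).unshift μ, μ⟩))) := by
  by_cases he : μ = b.dir
  · subst he
    simp only [lt_irrefl, dif_neg, not_false_eq_true, sub_self, if_true]
  · rw [if_neg he]
    rcases lt_or_gt_of_ne he with h1 | h2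
    · have h2 : ¬ b.dir < μ := lt_asymm h1
      rw [dif_pos h1, dif_neg h2, sub_zero, KY_apply, KY_apply]
      simp only [shift_unshift, unshift_shift_comm]
      abel
    · have h1 : ¬ μ < b.dir := lt_asymm h2
      rw [dif_neg h1, dif_pos h2, zero_sub, KY_apply, KY_apply]
      simp only [shift_unshift, unshift_shift_comm]
      abel

/-- ★★★ **(3.71), SECOND EQUALITY — THE OUTPUT-SIDE PRODUCT RULE for the flat co-curl of the zeroth-order word**: `−c_f·D*₁(K_VX) = B¹⁰_VX + Σ_μ W_{V,μ}(∇_μX)`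
pointwise — the transverse backward difference of `(R(V) − 1)·X(shifted edge)` splits into (VARIATION of the transporter)·X [the `V⁰`-part, one more `c_f`] plus
(transporter − 1)·(FLAT DERIVATIVE of X) [the `V¹`-words], the `c_f`'s cancelling exactly as in print. [cite: Balaban1985BackgroundPropagators, (3.71) pp.404–405, (3.73) p.405] -/
theorem neg_cf_coCurlY_one_KY_apply (V : CfgY 𝔸 i) (X : FBondY i → 𝔸) (b : FBondY i) :
    -(((i.cf : ℝ) : ℂ) • coCurlY i (fun _ _ => (1 : 𝔸ˣ)) (KY i V X) b) = B10Y i V X b + ∑ μ, WY i V μ (nablaY i μ X) b := by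
  rw [coCurlY_one_apply, B10Y_apply, smul_smul, ← smul_neg, ← Finset.sum_neg_distrib, Finset.smul_sum, Finset.smul_sum,
    ← Finset.sum_add_distrib]
  refine Finset.sum_congr rfl fun μ _ => ?_
  rw [coCurl_KY_summand, WY_apply]
  by_cases he : μ = b.dir
  · simp [he]
  · have eb : (⟨b.src, b.dir⟩ : FBondY i) = b := rfl
    simp only [if_neg he]
    rw [nablaY_apply, nablaY_apply, eb]
    simp only [shift_unshift, R_sub, R_smul, smul_sub, neg_sub, smul_smul]
    module

/-- ★★★ the same as an identity of `ℂ`-linear maps: `−c_f·(D*₁ ∘ K_V) = B¹⁰_V + Σ_μ W_{V,μ} ∘ ∇_μ`. [cite: Balaban1985BackgroundPropagators, (3.71) pp.404–405] -/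
theorem neg_cf_coCurlY_one_comp_KY (V : CfgY 𝔸 i) :
    -(((i.cf : ℝ) : ℂ) • (coCurlY i (fun _ _ => (1 : 𝔸ˣ)) ∘ₗ KY i V)) = B10Y i V + ∑ μ, WY i V μ ∘ₗ nablaY i μ := by
  refine LinearMap.ext fun X => funext fun b => ?_
  rw [LinearMap.neg_apply, LinearMap.smul_apply, Pi.neg_apply, Pi.smul_apply, LinearMap.comp_apply, neg_cf_coCurlY_one_KY_apply,
    LinearMap.add_apply, Pi.add_apply, LinearMap.coe_sum, Finset.sum_apply, Finset.sum_apply]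
  rfl


/-! ## §3  THE `V⁰ + Σ_μ V¹_μ∘∇_μ` FORM OF THE HESSIAN DIFFERENCE and its realification (the `hLap` input of G-F5's `cor35_G_cube_of_pieces`) -/

/-- **the zeroth-order part `V⁰` of `Δ(1) − Δ(V)`**: `B¹⁰_V − c_f·(D*_V𝒦_V − D*₁)∘K_V − Δ′₂(V)` (variation term; product of two small factors; curvature commutator).
[cite: Balaban1985BackgroundPropagators, (3.71) pp.404–405, (3.73) p.405, (3.10) p.392] -/
def V0Y (V : CfgY 𝔸 i) : (FBondY i → 𝔸) →ₗ[ℂ] (FBondY i → 𝔸) :=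
  B10Y i V - ((i.cf : ℝ) : ℂ) • ((coCurlY i V ∘ₗ jordanY i V - coCurlY i (fun _ _ => 1)) ∘ₗ KY i V) - curv2Y i V

/-- **the first-order words `V¹_μ` of `Δ(1) − Δ(V)`**: `W_{V,μ} − (D*_V𝒦_V − D*₁)∘sel_μ`. [cite: Balaban1985BackgroundPropagators, (3.71) pp.404–405, (3.73) p.405] -/
def V1Y (V : CfgY 𝔸 i) (μ : Fin (d + 1)) : (FBondY i → 𝔸) →ₗ[ℂ] (FBondY i → 𝔸) :=
  WY i V μ - (coCurlY i V ∘ₗ jordanY i V - coCurlY i (fun _ _ => 1)) ∘ₗ selY i μ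

/-- ★★★ **(3.71) AT def-Y'S LETTERS: THE HESSIAN DIFFERENCE IS A LOCAL FIRST-ORDER OPERATOR IN THE FLAT BOND DERIVATIVES**, `Δ(1) − Δ(V) = V⁰ + Σ_μ V¹_μ∘∇_μ`, with the
explicit letters `V0Y`, `V1Y` (whose (3.73)-sizes under the (3.37) windows are the estimates file's business). [cite: Balaban1985BackgroundPropagators, (3.71) pp.404–405, (3.73) p.405] -/
theorem hessY_one_sub_hessY_eq (V : CfgY 𝔸 i) :
    hessY i (fun _ _ => 1) - hessY i V = V0Y i V + ∑ μ, V1Y i V μ ∘ₗ nablaY i μ := by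
  rw [hessY_one_sub_hessY_split, V0Y]
  have h3 : ((i.cf : ℝ) : ℂ) • (coCurlY i (fun _ _ => (1 : 𝔸ˣ)) ∘ₗ KY i V) = -(B10Y i V + ∑ μ, WY i V μ ∘ₗ nablaY i μ) := by
    rw [← neg_cf_coCurlY_one_comp_KY, neg_neg]
  have e1 : ∑ μ, V1Y i V μ ∘ₗ nablaY i μ =
      ∑ μ, WY i V μ ∘ₗ nablaY i μ - (coCurlY i V ∘ₗ jordanY i V - coCurlY i (fun _ _ => 1)) ∘ₗ ∑ μ, selY i μ ∘ₗ nablaY i μ := by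
    have e2 : (coCurlY i V ∘ₗ jordanY i V - coCurlY i (fun _ _ => 1)) ∘ₗ ∑ μ, selY i μ ∘ₗ nablaY i μ =
        ∑ μ, (coCurlY i V ∘ₗ jordanY i V - coCurlY i (fun _ _ => 1)) ∘ₗ (selY i μ ∘ₗ nablaY i μ) := by
      refine LinearMap.ext fun X => ?_
      rw [LinearMap.comp_apply, LinearMap.coe_sum, LinearMap.coe_sum, Finset.sum_apply, Finset.sum_apply, map_sum]
      rfl
    rw [e2, ← Finset.sum_sub_distrib]
    refine Finset.sum_congr rfl fun μ _ => ?_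
    rw [V1Y, LinearMap.sub_comp, LinearMap.comp_assoc]
  rw [e1, h3]
  abel

omit [CompleteSpace 𝔸] in
/-- `conj b` is additive (r05's `conj_sub`/`conj_neg`). [cite: Balaban1984PropagatorsII, (2.51) p.232, bookkeeping] -/
theorem conj_add'' {ιb : Type} [Fintype ιb] (b : Module.Basis ιb ℝ 𝔸) {S : Type} (T₁ T₂ : Module.End ℝ (S → 𝔸)) :
    B9Eq352DivFormLetters.conj b (T₁ + T₂) = B9Eq352DivFormLetters.conj b T₁ + B9Eq352DivFormLetters.conj b T₂ := by
  rw [← sub_neg_eq_add, B9Eq352DivFormLetters.conj_sub, B9Eq352DivFormLetters.conj_neg, sub_neg_eq_add]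

omit [CompleteSpace 𝔸] in
/-- `conj b` passes finite sums. [cite: Balaban1984PropagatorsII, (2.51) p.232, bookkeeping] -/
theorem conj_finset_sum {ιb : Type} [Fintype ιb] (b : Module.Basis ιb ℝ 𝔸) {S κ : Type} (s : Finset κ) (T : κ → Module.End ℝ (S → 𝔸)) :
    B9Eq352DivFormLetters.conj b (∑ k ∈ s, T k) = ∑ k ∈ s, B9Eq352DivFormLetters.conj b (T k) := by
  classical
  induction s using Finset.induction_on with
  | empty =>
    rw [Finset.sum_empty, Finset.sum_empty, ← sub_self (0 : Module.End ℝ (S → 𝔸)), B9Eq352DivFormLetters.conj_sub, sub_self]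
  | insert k s hk ih => rw [Finset.sum_insert hk, Finset.sum_insert hk, conj_add'', ih]

/-- ★★★ **REALIFIED — THE `hLap` INPUT OF `B9Cor35GAtCubeLetters.cor35_G_cube_of_pieces`** (whose `lapPieceK b i V` is by definition the left side):
`conj b((Δ(1) − Δ(V))^ℝ) = conj b(V⁰) + Σ_μ conj b(V¹_μ)·DK b i μ`. [cite: Balaban1985BackgroundPropagators, (3.71) pp.404–405, (3.82)–(3.85) p.407; Balaban1984PropagatorsII, (2.51) p.232] -/
theorem conj_hessY_one_sub_hessY_eq {ιb : Type} [Fintype ιb] (b : Module.Basis ιb ℝ 𝔸) (V : CfgY 𝔸 i) :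
    B9Eq352DivFormLetters.conj b ((hessY i (fun _ _ => 1) - hessY i V).restrictScalars ℝ) =
      B9Eq352DivFormLetters.conj b ((V0Y i V).restrictScalars ℝ) +
        ∑ μ, B9Eq352DivFormLetters.conj b ((V1Y i V μ).restrictScalars ℝ) * DK b i μ := by
  rw [hessY_one_sub_hessY_eq]
  have e : ((V0Y i V + ∑ μ, V1Y i V μ ∘ₗ nablaY i μ).restrictScalars ℝ) =
      (V0Y i V).restrictScalars ℝ + ∑ μ, (V1Y i V μ).restrictScalars ℝ * (nablaY i μ).restrictScalars ℝ := by
    refine LinearMap.ext fun X => ?_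
    simp only [LinearMap.restrictScalars_apply, LinearMap.add_apply, LinearMap.coe_sum, Finset.sum_apply, Module.End.mul_apply,
      LinearMap.comp_apply]
  rw [e, conj_add'', conj_finset_sum]
  congr 1
  refine Finset.sum_congr rfl fun μ _ => ?_
  rw [B9Eq352DivFormLetters.conj_mul]
  rfl

end Literature.MathematicalPhysics.QuantumFieldTheory.Balaban1983to89.B9Eq371CoCurlLeibnizY

end
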